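import Summits.QuantumFields.YangMills.Theorems.UnitScaleTiltProp7TwistedSliceGaugeCorrectionAny
import Summits.QuantumFields.YangMills.Theorems.UnitScaleTiltProp7SliceTangentOfKerQTwST3
import Summits.QuantumFields.YangMills.Theorems.UnitScaleTiltProp7LandauTransversalityMarginSU2Chart
import Summits.QuantumFields.YangMills.Theorems.UnitScaleTiltProp7TwistedSliceGaugeOntoSU2
import Summits.QuantumFields.YangMills.Theorems.UnitScaleTiltProp7FrameResponseSU2T3
import Summits.QuantumFields.YangMills.Theorems.UnitScaleTiltProp7SectET3WCurrentRealityLettersT3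
import Summits.QuantumFields.YangMills.Theorems.UnitScaleTiltProp7SliceChainOfPlaqSmall
import HarnessLib

/-!
# Route `UnitScaleTilt`, crux K1 child «MinimiserStabilityRegPr» (stmt-QuantumFields-19200), skeleton v10, stub `stub_existenceMinimalOrbit` (EX), route (α) — **THE «SPLIT127-BRIDGE»:
# the display's row `hSplit′` («every real `ξ ∈ ker QSym(U′)` is a slice velocity plus a gauge direction») IMPLIES the door's row `hSplit127` («the chart-ray velocity of every real
# `δ ∈ ker QTwS(U₀)` is a slice velocity plus a gauge direction»), with NO residual row: the reality of the symmetric-frame response («FRAME-RESPONSE-SU2») is px21 g3's ✓`Prop7FrameResponseSU2.frameResponse_skew_traceless`, consumed inside**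

Cell `ym3-torus`, width seat `ym3-torus-px5` (gen 3); EX namer ★w2-19200 g7 WORD (8) «px5 g3: SPLIT127-BRIDGE LOCATE GO» (2026-08-28 23:58Z); LOCATE-SPLIT127-BRIDGE-px5g3.md §1 (19200 evidence
#57); px21 g3 00:15:32Z «I take brick (4) FRAME-RESPONSE-SU2; (3′)+(6) BRIDGE = px5's pen».  THEOREMS ONLY (0 `def`, 0 `sorry`); `--supports stmt-QuantumFields-19200 --as helper`,
count-neutral.  YM₃ on T³ is a ladder rung (R3), not the Clay problem; nothing here claims the stub, the crux, d = 4 or the mass gap; `hSplit′` (the display's row) is the INPUT.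

THE CHAIN (letters of ✓`Prop7HSplitDOfPairing.hSplitD_of_pairing`: window `(hε₀ he hWe hWε hε₀' hε')`, `U₀ ∈ 𝔘_k(ε₀)`, the (46) letter `H` (`hb hHop hHR`), `9C₂ˢbε < 1`, `6ε ≤ eη`,
`Chart47T3twS`, `Q(U₀)∘H = id`, the chart coordinate `A′` (real, `2‖A′‖ < ε`), the chart point `U′(b) = e^{χ(A′)(b)}U₀(b) ∈ 𝔘_k(ε₀′)`).  Given `D` with `HasFDerivAt χ D A′` and a REAL `δ` with
`QTwS U₀ δ = 0`:  (1) ✓`Prop7SliceTangentOfKerQTwS.fderiv_logChartTwS_chart_apply_eq_zero_of_QTwS_eq_zero` (px21, (48)-twS differentiated): `α := Dδ` is a twisted-slice tangent at `A₁ := χ(A′)`;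
(2) ✓`…skew_traceless_fderiv_chart_apply` (px21, (51)): `Dδ` is real; ✓`chartPoint_su2_norm`: `‖A₁‖ < eη`, `A₁` real;  (3) ✓`Prop7TwistedSliceGaugeCorrectionAny.exists_su2_gaugeDir_QSym_velocity_sub_eq_zero`
(this seat, over ★w5-20520 g6's T3 + ✓`QSym_gaugeDir_of_regPr`) fed with px21 g3's ✓`frameResponse_skew_traceless` (the frame response `λ_{Dδ}` is `𝔰𝔲(2)`-valued): an everywhere `𝔰𝔲(2)`-valued `N` with
`QSym U′ (M(Dδ) − G_{U′}N) = 0`;  (4) `ξ := M(Dδ) − G_{U′}N` is real (✓`star_gSer_ad_apply_of_skew`, ✓`trace_gSer_ad_apply`, unitarity of `U′`);  (5) `hSplit′` at `(D, ξ)`: `ξ = M(Dδ_L) + G_{U′}(iN₁)`,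
`δ_L` real, `QTwS δ_L = 0 ∧ Sl δ_L`;  (6) `M(Dδ) = M(Dδ_L) + G_{U′}(i(N₁ − iN))` — the 4-line `abel` of ✓`hSplitD_of_pairing` :104–107.
WHY IT ANSWERS THE NAMER («does the gauge factor `u` differentiate into the `gaugeDir(N)` summand?»): yes — infinitesimally the gauge factor IS T2's frame response `λ_α`; `QSym(U′)` reads it as
the fine gauge direction of any extension (T3), and the two gauge directions add.

WHAT IS PROVED (ns `…Theorems.Prop7Split127OfSplitD`): `gaugeDir_skew_traceless` (a real gauge parameter gives a real gauge direction at a unitary `U′`),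
★★★ `hSplit127_of_hSplitD` — `hSplit′ ⟹ hSplit127` in ✓p650826's shape (`Ker := QTwS U₀ · = 0`, generic `Sl`), generic chart point `U′` with `hU′`.
HONEST SCOPE.  Plumbing over landed theorems; `hSplit′` is a hypothesis; nothing of `hSplit′`'s own inhabitant ((P1)∕(P2), the pairing test), EX or the crux is proved.

References: T. Bałaban, CMP 102 (1985) 277–309 [Balaban1985Variational] ((44)–(51) pp.285–286, (82)–(83) p.290, (123)–(127) pp.296–297); CMP 98 (1985) 17–51 [Balaban1985Averaging]
((11) p.19, (87) p.31, (97) p.32); CMP 99 (1985) 75–102 [Balaban1985RegularSpaces] (Sect. D pp.89–95).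
-/

set_option autoImplicit false

noncomputable section

open scoped InnerProductSpace Matrix.Norms.L2Operator Matrix Topology RightActions
open Filter Metric NormedSpace

namespace Summit.QuantumFields.YangMills.Theorems.Prop7Split127OfSplitD

open Literature.Analysis.Calculus.ExpDifferential (ad gSer)
open Literature.MathematicalPhysics.QuantumFieldTheory.Balaban1983to89
open Literature.MathematicalPhysics.QuantumFieldTheory.Balaban1983to89.T3ContinuumYM3Torus
open T3PrintedRegularMinimiser (RegPr)
open T3SectALandauChart (eta eta_pos bgUnits)
open B11Prop3Model (Dfix)
open Summit.QuantumFields.YangMills.Theorems.Prop7SymAvgTwSym (frameTwS logChartTwS QTwS CmapTwS Chart47T3twS)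
open Summit.QuantumFields.YangMills.Theorems.Prop7SymAvgGL (QSym)
open Summit.QuantumFields.YangMills.Theorems.Prop7SliceTangentOfKerQTwS (fderiv_logChartTwS_chart_apply_eq_zero_of_QTwS_eq_zero skew_traceless_fderiv_chart_apply)
open Summit.QuantumFields.YangMills.Theorems.Prop7LandauTransversalityMarginSU2Chart (chartPoint_su2_norm)
open Summit.QuantumFields.YangMills.Theorems.Prop7TwistedSliceGaugeCorrectionAny (exists_su2_gaugeDir_QSym_velocity_sub_eq_zero)
open Summit.QuantumFields.YangMills.Theorems.Prop7SliceChainOfPlaqSmall (exists_su2_gaugeDir_QSym_velocity_sub_eq_zero_of_plaqSmall)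
open Summit.QuantumFields.YangMills.Theorems.Prop7TwistedSliceGaugeOntoSU2 (coe_bgUnits_apply)
open Summit.QuantumFields.YangMills.Theorems.Prop7ChartVelocitySU2 (star_gSer_ad_apply_of_skew trace_gSer_ad_apply)
open Summit.QuantumFields.YangMills.Theorems.Prop7FrameResponseSU2 (frameResponse_skew_traceless)
open Summit.QuantumFields.YangMills.Theorems.Prop7SectET3WCurrentRealityLetters (isHermitian_trace_zero_negI_smul)

variable (F : T3Family) {n K : ℕ} (h : n ≤ K)

/-! ## §1 Letters: reality of gauge directions -/

/-- A real (skew-Hermitian traceless) gauge parameter gives a real gauge direction at a unitary background: `(N(b₋) − U N(b₊) U⋆)` is skew-Hermitian traceless for `U U⋆ = 1`.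
[cite: Balaban1985Variational, (82)-(83) p.290] -/
theorem gaugeDir_skew_traceless {Ns Nt U : Matrix (Fin 2) (Fin 2) ℂ} (hs : star Ns = -Ns ∧ Ns.trace = 0) (ht : star Nt = -Nt ∧ Nt.trace = 0) (hU : star U * U = 1) :
    star (Ns - U * Nt * star U) = -(Ns - U * Nt * star U) ∧ (Ns - U * Nt * star U).trace = 0 := by
  refine ⟨?_, ?_⟩
  · rw [star_sub, star_mul, star_mul, star_star, hs.1, ht.1, ← mul_assoc, mul_neg, neg_mul]
    abel
  · rw [Matrix.trace_sub, hs.2, Matrix.trace_mul_cycle, hU, one_mul, ht.2, sub_zero]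

/-! ## §2 ★★★ The bridge -/

/-- ★★★ **«SPLIT127-BRIDGE»: `hSplit′ ⟹ hSplit127`.**  In the letters of ✓`hSplitD_of_pairing` (window, `U₀ ∈ 𝔘_k(ε₀)`, the real (46) letter `H` with `Q(U₀)∘H = id`,
`Chart47T3twS`, the real chart coordinate `A′` in the half ball, the printed-regular chart point `U′ = e^{χ(A′)}U₀`), with a generic slice predicate `Sl`: the display's row `hSplitD` (every real
`ξ ∈ ker QSym(U′)` is `M(Dδ) + G_{U′}(iN)`, `δ` real, `QTwS U₀ δ = 0`, `Sl δ`, `N` Hermitian traceless) gives: for every Fréchet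
derivative `D` of `χ` at `A′` and every REAL `δ` with `QTwS U₀ δ = 0`, there are `δ_L` real with `QTwS U₀ δ_L = 0`, `Sl δ_L`, and `N` Hermitian traceless with
`M(Dδ) = M(Dδ_L) + G_{U′}(iN)` — the `hSplit127` row of ✓`Prop7Crit127OfCrit93Split.hCrit127_of_hCrit93_of_split127` ∕ of px16's ✓`…H128OfCrit127FamilyAtRecord`.
[cite: Balaban1985Variational, (44)-(51) pp.285-286, (82)-(83) p.290, (123)-(127) pp.296-297; Balaban1985Averaging, (11) p.19, (87) p.31, (97) p.32; Balaban1985RegularSpaces, Sect. D pp.89-95] -/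
theorem hSplit127_of_hSplitD [Fact (0 < (F.L : ℝ))] [Fact (0 < ((F.L : ℝ)⁻¹) ^ (K - n))]
    {ε₀ ε₀' e b ε : ℝ} (hε₀ : 0 < ε₀) (he : 0 < e) (hWe : 10 ^ 9 * (F.L : ℝ) ^ 2 * e ≤ 1) (hWε : 10 ^ 12 * (F.L : ℝ) ^ 3 * ε₀ ≤ 1)
    (hε₀' : 0 < ε₀') (hε' : 10 ^ 7 * (F.L : ℝ) ^ 3 * ε₀' ≤ 1)
    (U₀ : GaugeField (F.P K) 0 (Matrix.specialUnitaryGroup (Fin 2) ℂ)) (hreg : RegPr F n K ε₀ U₀)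
    {H : (PBond (F.P n) 0 → Matrix (Fin 2) (Fin 2) ℂ) →ₗ[ℂ] (PBond (F.P K) 0 → Matrix (Fin 2) (Fin 2) ℂ)} (hb : 0 ≤ b) (hHop : ∀ Y, ‖H Y‖ ≤ b * ‖Y‖)
    (hHR : ∀ Y : PBond (F.P n) 0 → Matrix (Fin 2) (Fin 2) ℂ, (∀ c, star (Y c) = -Y c ∧ (Y c).trace = 0) → ∀ b', star (H Y b') = -H Y b' ∧ (H Y b').trace = 0)
    (hq : 9 * (40 * (2 * (3 * (2 * e + 2700 * (F.L : ℝ) * ε₀))) / (e * eta F n K) ^ 2) * b * ε < 1) (hRε : 6 * ε ≤ e * eta F n K)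
    (h47 : Chart47T3twS F n K h (40 * (2 * (3 * (2 * e + 2700 * (F.L : ℝ) * ε₀))) / (e * eta F n K) ^ 2) ε U₀ H) (hQH : ∀ X, QTwS F n K h U₀ (H X) = X)
    {A' : PBond (F.P K) 0 → Matrix (Fin 2) (Fin 2) ℂ} (hA' : 2 * ‖A'‖ < ε) (hA'R : ∀ b', star (A' b') = -A' b' ∧ (A' b').trace = 0)
    (U' : GaugeField (F.P K) 0 (Matrix.specialUnitaryGroup (Fin 2) ℂ)) (hreg' : RegPr F n K ε₀' U')
    (hU' : ∀ b, ((U' b : Matrix.specialUnitaryGroup (Fin 2) ℂ) : Matrix (Fin 2) (Fin 2) ℂ) = exp ((A' - H (Dfix (CmapTwS F n K h U₀) H (40 * (2 * (3 * (2 * e + 2700 * (F.L : ℝ) * ε₀))) / (e * eta F n K) ^ 2) A')) b) * ((U₀ b : Matrix.specialUnitaryGroup (Fin 2) ℂ) : Matrix (Fin 2) (Fin 2) ℂ))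
    (Sl : (PBond (F.P K) 0 → Matrix (Fin 2) (Fin 2) ℂ) → Prop)
    -- ▢ the display's row `hSplit′` ∕ `hSplitD` at this member (✓`hSplitD_of_pairing`'s conclusion shape, `Sl` generic)
    (hSplitD : ∀ D : (PBond (F.P K) 0 → Matrix (Fin 2) (Fin 2) ℂ) →L[ℂ] (PBond (F.P K) 0 → Matrix (Fin 2) (Fin 2) ℂ),
      HasFDerivAt (fun A : PBond (F.P K) 0 → Matrix (Fin 2) (Fin 2) ℂ =>
        A - H (Dfix (CmapTwS F n K h U₀) H (40 * (2 * (3 * (2 * e + 2700 * (F.L : ℝ) * ε₀))) / (e * eta F n K) ^ 2) A)) D A' →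
      ∀ ξ : PBond (F.P K) 0 → Matrix (Fin 2) (Fin 2) ℂ, (∀ b', star (ξ b') = -ξ b' ∧ (ξ b').trace = 0) →
      QSym F n K h U' ξ = 0 →
      ∃ δ : PBond (F.P K) 0 → Matrix (Fin 2) (Fin 2) ℂ, (∀ b', star (δ b') = -δ b' ∧ (δ b').trace = 0) ∧
        (QTwS F n K h U₀ δ = 0 ∧ Sl δ) ∧
        ∃ N : Site (F.P K) 0 → Matrix (Fin 2) (Fin 2) ℂ, (∀ x, (N x).IsHermitian ∧ (N x).trace = 0) ∧
          ∀ b' : PBond (F.P K) 0, ξ b' = gSer ℂ (ad ℂ (-(A' - H (Dfix (CmapTwS F n K h U₀) H (40 * (2 * (3 * (2 * e + 2700 * (F.L : ℝ) * ε₀))) / (e * eta F n K) ^ 2) A')) b')) ((D δ) b')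
            + (Complex.I • N b'.src - ((U' b' : Matrix.specialUnitaryGroup (Fin 2) ℂ) : Matrix (Fin 2) (Fin 2) ℂ) * (Complex.I • N b'.tgt) * star ((U' b' : Matrix.specialUnitaryGroup (Fin 2) ℂ) : Matrix (Fin 2) (Fin 2) ℂ))) :
    ∀ D : (PBond (F.P K) 0 → Matrix (Fin 2) (Fin 2) ℂ) →L[ℂ] (PBond (F.P K) 0 → Matrix (Fin 2) (Fin 2) ℂ),
      HasFDerivAt (fun A : PBond (F.P K) 0 → Matrix (Fin 2) (Fin 2) ℂ =>
        A - H (Dfix (CmapTwS F n K h U₀) H (40 * (2 * (3 * (2 * e + 2700 * (F.L : ℝ) * ε₀))) / (e * eta F n K) ^ 2) A)) D A' →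
      ∀ δ : PBond (F.P K) 0 → Matrix (Fin 2) (Fin 2) ℂ, (∀ b', star (δ b') = -δ b' ∧ (δ b').trace = 0) → QTwS F n K h U₀ δ = 0 →
      ∃ δL : PBond (F.P K) 0 → Matrix (Fin 2) (Fin 2) ℂ, (∀ b', star (δL b') = -δL b' ∧ (δL b').trace = 0) ∧ (QTwS F n K h U₀ δL = 0 ∧ Sl δL) ∧
        ∃ N : Site (F.P K) 0 → Matrix (Fin 2) (Fin 2) ℂ, (∀ x, (N x).IsHermitian ∧ (N x).trace = 0) ∧
          ∀ b' : PBond (F.P K) 0, gSer ℂ (ad ℂ (-(A' - H (Dfix (CmapTwS F n K h U₀) H (40 * (2 * (3 * (2 * e + 2700 * (F.L : ℝ) * ε₀))) / (e * eta F n K) ^ 2) A')) b')) ((D δ) b')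
            = gSer ℂ (ad ℂ (-(A' - H (Dfix (CmapTwS F n K h U₀) H (40 * (2 * (3 * (2 * e + 2700 * (F.L : ℝ) * ε₀))) / (e * eta F n K) ^ 2) A')) b')) ((D δL) b')
              + (Complex.I • N b'.src - ((U' b' : Matrix.specialUnitaryGroup (Fin 2) ℂ) : Matrix (Fin 2) (Fin 2) ℂ) * (Complex.I • N b'.tgt) * star ((U' b' : Matrix.specialUnitaryGroup (Fin 2) ℂ) : Matrix (Fin 2) (Fin 2) ℂ)) := by
  intro D hD δ hδR hδK
  have hA'1 : ‖A'‖ < ε := by nlinarith [norm_nonneg A']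
  obtain ⟨hA₁e, hA₁R, -⟩ := chartPoint_su2_norm F h hε₀ he hWe hWε U₀ hreg hb hHop hHR hq hRε h47 hA'1 hA'R
  -- (1) `α := Dδ` is a twisted-slice tangent at `χ(A′)`
  have hα := fderiv_logChartTwS_chart_apply_eq_zero_of_QTwS_eq_zero F h hε₀ he hWe hWε U₀ hreg hb hHop hq hRε hQH hA' hD hδK
  -- (2) `Dδ` is real
  have hDδR := skew_traceless_fderiv_chart_apply F h hε₀ he hWe hWε U₀ hreg hb hHop hHR hq hRε hA' hA'R hD hδR
  -- (3) an `𝔰𝔲(2)`-valued gauge correction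
  obtain ⟨N, hNR, hQ0⟩ := exists_su2_gaugeDir_QSym_velocity_sub_eq_zero F h hε₀ he hWe hWε hε₀' hε' U₀ U' hreg hreg' _ hA₁e hU' (D δ) hα
    (fun y => frameResponse_skew_traceless F h hε₀ he hWe hWε U₀ hreg hA₁e hA₁R hDδR y)
  -- unit letters of `U′`
  have hUb : ∀ b' : PBond (F.P K) 0, ((bgUnits F K U' b' : (Matrix (Fin 2) (Fin 2) ℂ)ˣ) : Matrix (Fin 2) (Fin 2) ℂ) = ((U' b' : Matrix.specialUnitaryGroup (Fin 2) ℂ) : Matrix (Fin 2) (Fin 2) ℂ) :=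
    fun b' => (coe_bgUnits_apply F U' b').1
  have hUbi : ∀ b' : PBond (F.P K) 0, (((bgUnits F K U' b')⁻¹ : (Matrix (Fin 2) (Fin 2) ℂ)ˣ) : Matrix (Fin 2) (Fin 2) ℂ) = star ((U' b' : Matrix.specialUnitaryGroup (Fin 2) ℂ) : Matrix (Fin 2) (Fin 2) ℂ) :=
    fun b' => (coe_bgUnits_apply F U' b').2
  have hUU : ∀ b' : PBond (F.P K) 0, star ((U' b' : Matrix.specialUnitaryGroup (Fin 2) ℂ) : Matrix (Fin 2) (Fin 2) ℂ) * ((U' b' : Matrix.specialUnitaryGroup (Fin 2) ℂ) : Matrix (Fin 2) (Fin 2) ℂ) = 1 := fun b' => Matrix.mem_unitaryGroup_iff'.1 (U' b').2.1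
  -- (4) `ξ := M(Dδ) − G_{U′}N` is real
  have hξR : ∀ b' : PBond (F.P K) 0,
      star (((fun b : PBond (F.P K) 0 => gSer ℂ (ad ℂ (-(A' - H (Dfix (CmapTwS F n K h U₀) H (40 * (2 * (3 * (2 * e + 2700 * (F.L : ℝ) * ε₀))) / (e * eta F n K) ^ 2) A')) b)) ((D δ) b))
          - fun b : PBond (F.P K) 0 => N b.src - ((bgUnits F K U' b : (Matrix (Fin 2) (Fin 2) ℂ)ˣ) : Matrix (Fin 2) (Fin 2) ℂ) * N b.tgt *
              (((bgUnits F K U' b)⁻¹ : (Matrix (Fin 2) (Fin 2) ℂ)ˣ) : Matrix (Fin 2) (Fin 2) ℂ)) b')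
        = -(((fun b : PBond (F.P K) 0 => gSer ℂ (ad ℂ (-(A' - H (Dfix (CmapTwS F n K h U₀) H (40 * (2 * (3 * (2 * e + 2700 * (F.L : ℝ) * ε₀))) / (e * eta F n K) ^ 2) A')) b)) ((D δ) b))
          - fun b : PBond (F.P K) 0 => N b.src - ((bgUnits F K U' b : (Matrix (Fin 2) (Fin 2) ℂ)ˣ) : Matrix (Fin 2) (Fin 2) ℂ) * N b.tgt *
              (((bgUnits F K U' b)⁻¹ : (Matrix (Fin 2) (Fin 2) ℂ)ˣ) : Matrix (Fin 2) (Fin 2) ℂ)) b') ∧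
      (((fun b : PBond (F.P K) 0 => gSer ℂ (ad ℂ (-(A' - H (Dfix (CmapTwS F n K h U₀) H (40 * (2 * (3 * (2 * e + 2700 * (F.L : ℝ) * ε₀))) / (e * eta F n K) ^ 2) A')) b)) ((D δ) b))
          - fun b : PBond (F.P K) 0 => N b.src - ((bgUnits F K U' b : (Matrix (Fin 2) (Fin 2) ℂ)ˣ) : Matrix (Fin 2) (Fin 2) ℂ) * N b.tgt *
              (((bgUnits F K U' b)⁻¹ : (Matrix (Fin 2) (Fin 2) ℂ)ˣ) : Matrix (Fin 2) (Fin 2) ℂ)) b').trace = 0 := by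
    intro b'
    have hA₁s : star (-(A' - H (Dfix (CmapTwS F n K h U₀) H (40 * (2 * (3 * (2 * e + 2700 * (F.L : ℝ) * ε₀))) / (e * eta F n K) ^ 2) A')) b') = -(-(A' - H (Dfix (CmapTwS F n K h U₀) H (40 * (2 * (3 * (2 * e + 2700 * (F.L : ℝ) * ε₀))) / (e * eta F n K) ^ 2) A')) b') := by rw [star_neg, (hA₁R b').1]
    have hM : star (gSer ℂ (ad ℂ (-(A' - H (Dfix (CmapTwS F n K h U₀) H (40 * (2 * (3 * (2 * e + 2700 * (F.L : ℝ) * ε₀))) / (e * eta F n K) ^ 2) A')) b')) ((D δ) b')) = -(gSer ℂ (ad ℂ (-(A' - H (Dfix (CmapTwS F n K h U₀) H (40 * (2 * (3 * (2 * e + 2700 * (F.L : ℝ) * ε₀))) / (e * eta F n K) ^ 2) A')) b')) ((D δ) b')) ∧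
        (gSer ℂ (ad ℂ (-(A' - H (Dfix (CmapTwS F n K h U₀) H (40 * (2 * (3 * (2 * e + 2700 * (F.L : ℝ) * ε₀))) / (e * eta F n K) ^ 2) A')) b')) ((D δ) b')).trace = 0 :=
      ⟨star_gSer_ad_apply_of_skew hA₁s (hDδR b').1, trace_gSer_ad_apply _ _ (hDδR b').2⟩
    have hG := gaugeDir_skew_traceless (hNR b'.src) (hNR b'.tgt) (hUU b')
    rw [Pi.sub_apply]
    simp only [hUb, hUbi]
    refine ⟨?_, ?_⟩
    · rw [star_sub, hM.1, hG.1]; abel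
    · rw [Matrix.trace_sub, hM.2, hG.2, sub_zero]
  -- (5) the display's row at `ξ`
  obtain ⟨δL, hδLR, hδLKS, N₁, hN₁, hξeq⟩ := hSplitD D hD _ hξR hQ0
  -- (6) add the two gauge directions
  refine ⟨δL, hδLR, hδLKS, fun x => N₁ x + (-Complex.I) • N x,
    fun x => ⟨(hN₁ x).1.add (isHermitian_trace_zero_negI_smul (hNR x)).1, by rw [Matrix.trace_add, (hN₁ x).2, (isHermitian_trace_zero_negI_smul (hNR x)).2, add_zero]⟩,
    fun b' => ?_⟩
  have hb := hξeq b'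
  rw [Pi.sub_apply] at hb
  simp only [hUb, hUbi] at hb
  have hI : ∀ x, Complex.I • (N₁ x + (-Complex.I) • N x) = Complex.I • N₁ x + N x := fun x => by
    rw [smul_add, smul_smul, mul_neg, Complex.I_mul_I, neg_neg, one_smul]
  rw [hI, hI]
  rw [sub_eq_iff_eq_add] at hb
  rw [hb, Matrix.mul_add, Matrix.add_mul]
  abel

/-- ★★★ **«SPLIT127-BRIDGE» v3 — THE CHART POINT's PLAQUETTE REGULARITY ONLY** (EX namer «v3 (`hplaq′`) after (C1)»; px16's ✓`Prop7SliceChainOfPlaqSmall` (C1) re-exports consumed):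
as `hSplit127_of_hSplitD` with `hreg′ : RegPr ε₀′ U′` replaced by `hplaq′ : PlaqSmall (regThreshold ε₀′) U′` — the print-acyclic input ((124)–(126) read plaquette regularity only). **`hSplit′ ⟹ hSplit127`.**  In the letters of ✓`hSplitD_of_pairing` (window, `U₀ ∈ 𝔘_k(ε₀)`, the real (46) letter `H` with `Q(U₀)∘H = id`,
`Chart47T3twS`, the real chart coordinate `A′` in the half ball, the printed-regular chart point `U′ = e^{χ(A′)}U₀`), with a generic slice predicate `Sl`: the display's row `hSplitD` (every real
`ξ ∈ ker QSym(U′)` is `M(Dδ) + G_{U′}(iN)`, `δ` real, `QTwS U₀ δ = 0`, `Sl δ`, `N` Hermitian traceless) gives: for every Fréchet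
derivative `D` of `χ` at `A′` and every REAL `δ` with `QTwS U₀ δ = 0`, there are `δ_L` real with `QTwS U₀ δ_L = 0`, `Sl δ_L`, and `N` Hermitian traceless with
`M(Dδ) = M(Dδ_L) + G_{U′}(iN)` — the `hSplit127` row of ✓`Prop7Crit127OfCrit93Split.hCrit127_of_hCrit93_of_split127` ∕ of px16's ✓`…H128OfCrit127FamilyAtRecord`.
[cite: Balaban1985Variational, (44)-(51) pp.285-286, (82)-(83) p.290, (123)-(127) pp.296-297; Balaban1985Averaging, (11) p.19, (87) p.31, (97) p.32; Balaban1985RegularSpaces, Sect. D pp.89-95] -/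
theorem hSplit127_of_hSplitD_of_plaqSmall [Fact (0 < (F.L : ℝ))] [Fact (0 < ((F.L : ℝ)⁻¹) ^ (K - n))]
    {ε₀ ε₀' e b ε : ℝ} (hε₀ : 0 < ε₀) (he : 0 < e) (hWe : 10 ^ 9 * (F.L : ℝ) ^ 2 * e ≤ 1) (hWε : 10 ^ 12 * (F.L : ℝ) ^ 3 * ε₀ ≤ 1)
    (hε₀' : 0 < ε₀') (hε' : 10 ^ 7 * (F.L : ℝ) ^ 3 * ε₀' ≤ 1)
    (U₀ : GaugeField (F.P K) 0 (Matrix.specialUnitaryGroup (Fin 2) ℂ)) (hreg : RegPr F n K ε₀ U₀)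
    {H : (PBond (F.P n) 0 → Matrix (Fin 2) (Fin 2) ℂ) →ₗ[ℂ] (PBond (F.P K) 0 → Matrix (Fin 2) (Fin 2) ℂ)} (hb : 0 ≤ b) (hHop : ∀ Y, ‖H Y‖ ≤ b * ‖Y‖)
    (hHR : ∀ Y : PBond (F.P n) 0 → Matrix (Fin 2) (Fin 2) ℂ, (∀ c, star (Y c) = -Y c ∧ (Y c).trace = 0) → ∀ b', star (H Y b') = -H Y b' ∧ (H Y b').trace = 0)
    (hq : 9 * (40 * (2 * (3 * (2 * e + 2700 * (F.L : ℝ) * ε₀))) / (e * eta F n K) ^ 2) * b * ε < 1) (hRε : 6 * ε ≤ e * eta F n K)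
    (h47 : Chart47T3twS F n K h (40 * (2 * (3 * (2 * e + 2700 * (F.L : ℝ) * ε₀))) / (e * eta F n K) ^ 2) ε U₀ H) (hQH : ∀ X, QTwS F n K h U₀ (H X) = X)
    {A' : PBond (F.P K) 0 → Matrix (Fin 2) (Fin 2) ℂ} (hA' : 2 * ‖A'‖ < ε) (hA'R : ∀ b', star (A' b') = -A' b' ∧ (A' b').trace = 0)
    (U' : GaugeField (F.P K) 0 (Matrix.specialUnitaryGroup (Fin 2) ℂ)) (hplaq' : PlaqSmall (T3RegularMinimiser.regThreshold F n K ε₀') U')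
    (hU' : ∀ b, ((U' b : Matrix.specialUnitaryGroup (Fin 2) ℂ) : Matrix (Fin 2) (Fin 2) ℂ) = exp ((A' - H (Dfix (CmapTwS F n K h U₀) H (40 * (2 * (3 * (2 * e + 2700 * (F.L : ℝ) * ε₀))) / (e * eta F n K) ^ 2) A')) b) * ((U₀ b : Matrix.specialUnitaryGroup (Fin 2) ℂ) : Matrix (Fin 2) (Fin 2) ℂ))
    (Sl : (PBond (F.P K) 0 → Matrix (Fin 2) (Fin 2) ℂ) → Prop)
    -- ▢ the display's row `hSplit′` ∕ `hSplitD` at this member (✓`hSplitD_of_pairing`'s conclusion shape, `Sl` generic)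
    (hSplitD : ∀ D : (PBond (F.P K) 0 → Matrix (Fin 2) (Fin 2) ℂ) →L[ℂ] (PBond (F.P K) 0 → Matrix (Fin 2) (Fin 2) ℂ),
      HasFDerivAt (fun A : PBond (F.P K) 0 → Matrix (Fin 2) (Fin 2) ℂ =>
        A - H (Dfix (CmapTwS F n K h U₀) H (40 * (2 * (3 * (2 * e + 2700 * (F.L : ℝ) * ε₀))) / (e * eta F n K) ^ 2) A)) D A' →
      ∀ ξ : PBond (F.P K) 0 → Matrix (Fin 2) (Fin 2) ℂ, (∀ b', star (ξ b') = -ξ b' ∧ (ξ b').trace = 0) →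
      QSym F n K h U' ξ = 0 →
      ∃ δ : PBond (F.P K) 0 → Matrix (Fin 2) (Fin 2) ℂ, (∀ b', star (δ b') = -δ b' ∧ (δ b').trace = 0) ∧
        (QTwS F n K h U₀ δ = 0 ∧ Sl δ) ∧
        ∃ N : Site (F.P K) 0 → Matrix (Fin 2) (Fin 2) ℂ, (∀ x, (N x).IsHermitian ∧ (N x).trace = 0) ∧
          ∀ b' : PBond (F.P K) 0, ξ b' = gSer ℂ (ad ℂ (-(A' - H (Dfix (CmapTwS F n K h U₀) H (40 * (2 * (3 * (2 * e + 2700 * (F.L : ℝ) * ε₀))) / (e * eta F n K) ^ 2) A')) b')) ((D δ) b')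
            + (Complex.I • N b'.src - ((U' b' : Matrix.specialUnitaryGroup (Fin 2) ℂ) : Matrix (Fin 2) (Fin 2) ℂ) * (Complex.I • N b'.tgt) * star ((U' b' : Matrix.specialUnitaryGroup (Fin 2) ℂ) : Matrix (Fin 2) (Fin 2) ℂ))) :
    ∀ D : (PBond (F.P K) 0 → Matrix (Fin 2) (Fin 2) ℂ) →L[ℂ] (PBond (F.P K) 0 → Matrix (Fin 2) (Fin 2) ℂ),
      HasFDerivAt (fun A : PBond (F.P K) 0 → Matrix (Fin 2) (Fin 2) ℂ =>
        A - H (Dfix (CmapTwS F n K h U₀) H (40 * (2 * (3 * (2 * e + 2700 * (F.L : ℝ) * ε₀))) / (e * eta F n K) ^ 2) A)) D A' →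
      ∀ δ : PBond (F.P K) 0 → Matrix (Fin 2) (Fin 2) ℂ, (∀ b', star (δ b') = -δ b' ∧ (δ b').trace = 0) → QTwS F n K h U₀ δ = 0 →
      ∃ δL : PBond (F.P K) 0 → Matrix (Fin 2) (Fin 2) ℂ, (∀ b', star (δL b') = -δL b' ∧ (δL b').trace = 0) ∧ (QTwS F n K h U₀ δL = 0 ∧ Sl δL) ∧
        ∃ N : Site (F.P K) 0 → Matrix (Fin 2) (Fin 2) ℂ, (∀ x, (N x).IsHermitian ∧ (N x).trace = 0) ∧
          ∀ b' : PBond (F.P K) 0, gSer ℂ (ad ℂ (-(A' - H (Dfix (CmapTwS F n K h U₀) H (40 * (2 * (3 * (2 * e + 2700 * (F.L : ℝ) * ε₀))) / (e * eta F n K) ^ 2) A')) b')) ((D δ) b')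
            = gSer ℂ (ad ℂ (-(A' - H (Dfix (CmapTwS F n K h U₀) H (40 * (2 * (3 * (2 * e + 2700 * (F.L : ℝ) * ε₀))) / (e * eta F n K) ^ 2) A')) b')) ((D δL) b')
              + (Complex.I • N b'.src - ((U' b' : Matrix.specialUnitaryGroup (Fin 2) ℂ) : Matrix (Fin 2) (Fin 2) ℂ) * (Complex.I • N b'.tgt) * star ((U' b' : Matrix.specialUnitaryGroup (Fin 2) ℂ) : Matrix (Fin 2) (Fin 2) ℂ)) := by
  intro D hD δ hδR hδK
  have hA'1 : ‖A'‖ < ε := by nlinarith [norm_nonneg A']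
  obtain ⟨hA₁e, hA₁R, -⟩ := chartPoint_su2_norm F h hε₀ he hWe hWε U₀ hreg hb hHop hHR hq hRε h47 hA'1 hA'R
  -- (1) `α := Dδ` is a twisted-slice tangent at `χ(A′)`
  have hα := fderiv_logChartTwS_chart_apply_eq_zero_of_QTwS_eq_zero F h hε₀ he hWe hWε U₀ hreg hb hHop hq hRε hQH hA' hD hδK
  -- (2) `Dδ` is real
  have hDδR := skew_traceless_fderiv_chart_apply F h hε₀ he hWe hWε U₀ hreg hb hHop hHR hq hRε hA' hA'R hD hδR
  -- (3) an `𝔰𝔲(2)`-valued gauge correction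
  obtain ⟨N, hNR, hQ0⟩ := exists_su2_gaugeDir_QSym_velocity_sub_eq_zero_of_plaqSmall F h hε₀ he hWe hWε hε₀' hε' U₀ U' hreg hplaq' _ hA₁e hU' (D δ) hα
    (fun y => frameResponse_skew_traceless F h hε₀ he hWe hWε U₀ hreg hA₁e hA₁R hDδR y)
  -- unit letters of `U′`
  have hUb : ∀ b' : PBond (F.P K) 0, ((bgUnits F K U' b' : (Matrix (Fin 2) (Fin 2) ℂ)ˣ) : Matrix (Fin 2) (Fin 2) ℂ) = ((U' b' : Matrix.specialUnitaryGroup (Fin 2) ℂ) : Matrix (Fin 2) (Fin 2) ℂ) :=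
    fun b' => (coe_bgUnits_apply F U' b').1
  have hUbi : ∀ b' : PBond (F.P K) 0, (((bgUnits F K U' b')⁻¹ : (Matrix (Fin 2) (Fin 2) ℂ)ˣ) : Matrix (Fin 2) (Fin 2) ℂ) = star ((U' b' : Matrix.specialUnitaryGroup (Fin 2) ℂ) : Matrix (Fin 2) (Fin 2) ℂ) :=
    fun b' => (coe_bgUnits_apply F U' b').2
  have hUU : ∀ b' : PBond (F.P K) 0, star ((U' b' : Matrix.specialUnitaryGroup (Fin 2) ℂ) : Matrix (Fin 2) (Fin 2) ℂ) * ((U' b' : Matrix.specialUnitaryGroup (Fin 2) ℂ) : Matrix (Fin 2) (Fin 2) ℂ) = 1 := fun b' => Matrix.mem_unitaryGroup_iff'.1 (U' b').2.1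
  -- (4) `ξ := M(Dδ) − G_{U′}N` is real
  have hξR : ∀ b' : PBond (F.P K) 0,
      star (((fun b : PBond (F.P K) 0 => gSer ℂ (ad ℂ (-(A' - H (Dfix (CmapTwS F n K h U₀) H (40 * (2 * (3 * (2 * e + 2700 * (F.L : ℝ) * ε₀))) / (e * eta F n K) ^ 2) A')) b)) ((D δ) b))
          - fun b : PBond (F.P K) 0 => N b.src - ((bgUnits F K U' b : (Matrix (Fin 2) (Fin 2) ℂ)ˣ) : Matrix (Fin 2) (Fin 2) ℂ) * N b.tgt *
              (((bgUnits F K U' b)⁻¹ : (Matrix (Fin 2) (Fin 2) ℂ)ˣ) : Matrix (Fin 2) (Fin 2) ℂ)) b')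
        = -(((fun b : PBond (F.P K) 0 => gSer ℂ (ad ℂ (-(A' - H (Dfix (CmapTwS F n K h U₀) H (40 * (2 * (3 * (2 * e + 2700 * (F.L : ℝ) * ε₀))) / (e * eta F n K) ^ 2) A')) b)) ((D δ) b))
          - fun b : PBond (F.P K) 0 => N b.src - ((bgUnits F K U' b : (Matrix (Fin 2) (Fin 2) ℂ)ˣ) : Matrix (Fin 2) (Fin 2) ℂ) * N b.tgt *
              (((bgUnits F K U' b)⁻¹ : (Matrix (Fin 2) (Fin 2) ℂ)ˣ) : Matrix (Fin 2) (Fin 2) ℂ)) b') ∧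
      (((fun b : PBond (F.P K) 0 => gSer ℂ (ad ℂ (-(A' - H (Dfix (CmapTwS F n K h U₀) H (40 * (2 * (3 * (2 * e + 2700 * (F.L : ℝ) * ε₀))) / (e * eta F n K) ^ 2) A')) b)) ((D δ) b))
          - fun b : PBond (F.P K) 0 => N b.src - ((bgUnits F K U' b : (Matrix (Fin 2) (Fin 2) ℂ)ˣ) : Matrix (Fin 2) (Fin 2) ℂ) * N b.tgt *
              (((bgUnits F K U' b)⁻¹ : (Matrix (Fin 2) (Fin 2) ℂ)ˣ) : Matrix (Fin 2) (Fin 2) ℂ)) b').trace = 0 := by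
    intro b'
    have hA₁s : star (-(A' - H (Dfix (CmapTwS F n K h U₀) H (40 * (2 * (3 * (2 * e + 2700 * (F.L : ℝ) * ε₀))) / (e * eta F n K) ^ 2) A')) b') = -(-(A' - H (Dfix (CmapTwS F n K h U₀) H (40 * (2 * (3 * (2 * e + 2700 * (F.L : ℝ) * ε₀))) / (e * eta F n K) ^ 2) A')) b') := by rw [star_neg, (hA₁R b').1]
    have hM : star (gSer ℂ (ad ℂ (-(A' - H (Dfix (CmapTwS F n K h U₀) H (40 * (2 * (3 * (2 * e + 2700 * (F.L : ℝ) * ε₀))) / (e * eta F n K) ^ 2) A')) b')) ((D δ) b')) = -(gSer ℂ (ad ℂ (-(A' - H (Dfix (CmapTwS F n K h U₀) H (40 * (2 * (3 * (2 * e + 2700 * (F.L : ℝ) * ε₀))) / (e * eta F n K) ^ 2) A')) b')) ((D δ) b')) ∧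
        (gSer ℂ (ad ℂ (-(A' - H (Dfix (CmapTwS F n K h U₀) H (40 * (2 * (3 * (2 * e + 2700 * (F.L : ℝ) * ε₀))) / (e * eta F n K) ^ 2) A')) b')) ((D δ) b')).trace = 0 :=
      ⟨star_gSer_ad_apply_of_skew hA₁s (hDδR b').1, trace_gSer_ad_apply _ _ (hDδR b').2⟩
    have hG := gaugeDir_skew_traceless (hNR b'.src) (hNR b'.tgt) (hUU b')
    rw [Pi.sub_apply]
    simp only [hUb, hUbi]
    refine ⟨?_, ?_⟩
    · rw [star_sub, hM.1, hG.1]; abel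
    · rw [Matrix.trace_sub, hM.2, hG.2, sub_zero]
  -- (5) the display's row at `ξ`
  obtain ⟨δL, hδLR, hδLKS, N₁, hN₁, hξeq⟩ := hSplitD D hD _ hξR hQ0
  -- (6) add the two gauge directions
  refine ⟨δL, hδLR, hδLKS, fun x => N₁ x + (-Complex.I) • N x,
    fun x => ⟨(hN₁ x).1.add (isHermitian_trace_zero_negI_smul (hNR x)).1, by rw [Matrix.trace_add, (hN₁ x).2, (isHermitian_trace_zero_negI_smul (hNR x)).2, add_zero]⟩,
    fun b' => ?_⟩
  have hb := hξeq b'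
  rw [Pi.sub_apply] at hb
  simp only [hUb, hUbi] at hb
  have hI : ∀ x, Complex.I • (N₁ x + (-Complex.I) • N x) = Complex.I • N₁ x + N x := fun x => by
    rw [smul_add, smul_smul, mul_neg, Complex.I_mul_I, neg_neg, one_smul]
  rw [hI, hI]
  rw [sub_eq_iff_eq_add] at hb
  rw [hb, Matrix.mul_add, Matrix.add_mul]
  abel

end Summit.QuantumFields.YangMills.Theorems.Prop7Split127OfSplitD

end
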